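import Summits.QuantumAdvantage.QuantumAdvantage.Theorems.OddPrimeWalkFibreTransfer
import HarnessLib

/-!
# OddPrimeWalk — `TwistBound` ON A FIBRE (item stmt-QuantumAdvantage-24323 `FibreTwistBoundFive`), part 2: the bound

Continuation of `OddPrimeWalkFibreTransfer` (site modes, pinned path sum, norm propagation): the per-site factors of a pinning
(`modeOf`, `siteRhoM`), the fibre correlation bound `corr_win_fibre_le`, the general-prime statement `fibreTwistBound` (`p ≠ 3`)
and the closer `oddPrimeWalk_fibreTwistBoundFive` (the route file's signature, verbatim).  Prover qn-prover-3 g20; plan: planner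
qa-qnc0-p2 g32, PROOF-MC §4 / Sketch32c.
WHAT THIS IS NOT: no statement about non-oblivious strategies; the rungs 24278/24257 need the cell expansion on top.
-/

noncomputable section

namespace Summit.QuantumAdvantage.AdviceFreeQNC0

open Finset Literature.Computability.MetaComplexity

namespace TwistedTransfer

open ConstBells

variable {n : ℕ}

section Site

variable {p : ℕ} [Fact p.Prime]

/-- The site phases have modulus `1` (or are `1`). -/
theorem norm_phase_le (β : Fin n → ZMod p) (i : ℕ) : ‖phase β i‖ ≤ 1 := by
  unfold phase
  by_cases h : i < n
  · rw [dif_pos h, show (ZMod.stdAddChar (β ⟨i, h⟩) : ℂ) = (ZMod.toCircle (β ⟨i, h⟩) : ℂ) from rfl,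
      Circle.norm_coe]
  · rw [dif_neg h]; simp

/-- The modes of a pinning `π` on `S ⊆ Fin n`. -/
def modeOf (S : Finset (Fin n)) (π : Fin n → Bool) (j : ℕ) : Option Bool :=
  if h : j < n then (if (⟨j, h⟩ : Fin n) ∈ S then some (π ⟨j, h⟩) else none) else none

/-- Admissible at offset `0` = lies on the fibre. -/
theorem adm_modeOf_iff (S : Finset (Fin n)) (π : Fin n → Bool) (u : Fin n → Bool) :
    Adm (modeOf S π) 0 n u ↔ ∀ i ∈ S, u i = π i := by
  unfold Adm modeOf
  constructor
  · intro h i hi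
    have := h i (π i) (by rw [zero_add, dif_pos i.isLt]; simp [hi])
    exact this
  · intro h i b hb
    rw [zero_add, dif_pos i.isLt] at hb
    simp only [Fin.eta] at hb
    by_cases hi : i ∈ S
    · rw [if_pos hi, Option.some.injEq] at hb
      rw [← hb]; exact h i hi
    · rw [if_neg hi] at hb; exact absurd hb (by simp)

/-- The free sites of a pinning are the complement of `S`. -/
theorem freeCnt_modeOf (S : Finset (Fin n)) (π : Fin n → Bool) : freeCnt (modeOf S π) 0 n = n - S.card := by
  unfold freeCnt
  have h : ((range n).filter fun i => modeOf S π (0 + i) = none) = (univ.filter fun i : Fin n => i ∉ S).map Fin.valEmbedding := by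
    ext j
    simp only [mem_filter, mem_range, mem_map, mem_univ, true_and, Fin.valEmbedding_apply, zero_add]
    constructor
    · rintro ⟨hj, hm⟩
      refine ⟨⟨j, hj⟩, ?_, rfl⟩
      intro hS
      unfold modeOf at hm
      rw [dif_pos hj, if_pos hS] at hm
      exact absurd hm (by simp)
    · rintro ⟨i, hi, rfl⟩
      refine ⟨i.isLt, ?_⟩
      unfold modeOf
      rw [dif_pos i.isLt]
      simp only [Fin.eta, if_neg hi]
  rw [h, card_map]
  have := Finset.card_filter_add_card_filter_not (s := (univ : Finset (Fin n))) (fun i => i ∈ S)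
  rw [filter_mem_eq_inter, univ_inter, card_univ, Fintype.card_fin] at this
  omega

/-- The per-site factors of a pinning: `ρ` at free sites with non-trivial phase, `1` elsewhere. -/
def siteRhoM (S : Finset (Fin n)) (β : Fin n → ZMod p) (ρ : ℝ) (i : ℕ) : ℝ :=
  if h : i < n then (if (⟨i, h⟩ : Fin n) ∉ S ∧ β ⟨i, h⟩ ≠ 0 then ρ else 1) else 1

/-- `Π_{i<n} siteRhoM² = (ρ²)^{#(supp β ∖ S)}`. -/
theorem prod_siteRhoM_sq (S : Finset (Fin n)) (β : Fin n → ZMod p) (ρ : ℝ) :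
    (∏ i ∈ range n, siteRhoM S β ρ (0 + i) ^ 2) = (ρ ^ 2) ^ ((univ \ S).filter fun i : Fin n => β i ≠ 0).card := by
  classical
  simp only [zero_add]
  rw [← Fin.prod_univ_eq_prod_range (fun i => siteRhoM S β ρ i ^ 2) n]
  have h : ∀ i : Fin n, siteRhoM S β ρ i.val ^ 2 = if (i ∉ S ∧ β i ≠ 0) then ρ ^ 2 else 1 := by
    intro i
    unfold siteRhoM
    rw [dif_pos i.isLt]
    simp only [Fin.eta]
    split_ifs <;> simp
  rw [Finset.prod_congr rfl (fun i _ => h i), Finset.prod_ite, Finset.prod_const, Finset.prod_const_one, mul_one]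
  congr 1
  congr 1
  ext i
  simp [mem_sdiff]

/-- The per-site contraction of the pinned steps. -/
theorem cnsq_stepM_modeOf_le {ρ : ℝ}
    (hsite : ∀ a : ZMod p, a ≠ 0 → ∀ v : ZMod 3 → ℂ, cnsq (twAvg (ZMod.stdAddChar a) v) ≤ ρ ^ 2 * cnsq v)
    (S : Finset (Fin n)) (π : Fin n → Bool) (β : Fin n → ZMod p) (g : ℕ) (v : ZMod 3 → ℂ) :
    cnsq (stepM (modeOf S π) (phase β) g v) ≤ siteRhoM S β ρ g ^ 2 * cnsq v := by
  unfold siteRhoM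
  by_cases hg : g < n
  · rw [dif_pos hg]
    by_cases hS : (⟨g, hg⟩ : Fin n) ∈ S
    · -- pinned site
      have hm : modeOf S π g = some (π ⟨g, hg⟩) := by unfold modeOf; rw [dif_pos hg, if_pos hS]
      rw [if_neg (fun h => h.1 hS), one_pow, one_mul]
      exact cnsq_stepM_pinned_le _ _ (norm_phase_le β) g _ hm v
    · -- free site
      have hm : modeOf S π g = none := by unfold modeOf; rw [dif_pos hg, if_neg hS]
      have e : stepM (modeOf S π) (phase β) g v = twAvg (phase β g) v := by unfold stepM; rw [hm]
      rw [e]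
      unfold phase
      rw [dif_pos hg]
      by_cases hb : β ⟨g, hg⟩ = 0
      · rw [if_neg (fun h => h.2 hb), hb, AddChar.map_zero_eq_one, one_pow, one_mul]
        exact cnsq_twAvg_le (by simp) v
      · rw [if_pos ⟨hS, hb⟩]
        exact hsite _ hb v
  · rw [dif_neg hg, one_pow, one_mul]
    have hm : modeOf S π g = none := by unfold modeOf; rw [dif_neg hg]
    have e : stepM (modeOf S π) (phase β) g v = twAvg (phase β g) v := by unfold stepM; rw [hm]
    rw [e]
    exact cnsq_twAvg_le (norm_phase_le β g) v

/-- The fibre twisted sum `Σ_{u ∈ fibre} sgnU(u)·e_p(⟨β,u⟩)` of a constant strategy `B` in transfer form. -/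
theorem sum_fibre_sgnU_char (c : ℕ) (B : Finset (Fin (n + 1))) (β : Fin n → ZMod p) (S : Finset (Fin n))
    (π : Fin n → Bool) :
    (∑ u ∈ univ.filter (fun u : Fin n → Bool => ∀ i ∈ S, u i = π i),
        (sgnU c B u : ℂ) * ∏ i : Fin n, (if u i then phase β i.val else 1)) =
      ∑ τ : ZMod 3, (2 : ℂ) ^ (n - S.card) *
        TBVM (modeOf S π) (phase β) (fT (bellsN B) n (((c + 2 * n : ℕ) : ZMod 3)) τ) 0 n 0 := by
  have hfib : univ.filter (fun u : Fin n → Bool => ∀ i ∈ S, u i = π i) = univ.filter (Adm (modeOf S π) 0 n) := by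
    ext u; simp only [mem_filter, mem_univ, true_and, adm_modeOf_iff]
  rw [hfib]
  have h : ∀ u : Fin n → Bool, (sgnU c B u : ℂ) * ∏ i : Fin n, (if u i then phase β i.val else 1) =
      ∑ τ : ZMod 3, ((∏ j ∈ range (n + 1), fT (bellsN B) n (((c + 2 * n : ℕ) : ZMod 3)) τ (0 + j)
        (0 + ((j + wtPrefix u j : ℕ) : ZMod 3)) : ℝ) : ℂ) * ∏ i : Fin n, (if u i then phase β (0 + i.val) else 1) := by
    intro u
    rw [sgnU_eq_sum, Complex.ofReal_sum, Finset.sum_mul]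
    simp only [zero_add]
    rfl
  simp_rw [h]
  rw [Finset.sum_comm]
  refine Finset.sum_congr rfl fun τ _ => ?_
  rw [twisted_pathSum_fibre (modeOf S π) (phase β) _ n 0 0, freeCnt_modeOf]

/-- The bound on one pinned twisted transfer vector: `|TBVM_0(0)| ≤ ρ^{#(supp β ∖ S)}`. -/
theorem norm_TBVM_le {ρ : ℝ} (hρ : 0 ≤ ρ)
    (hsite : ∀ a : ZMod p, a ≠ 0 → ∀ v : ZMod 3 → ℂ, cnsq (twAvg (ZMod.stdAddChar a) v) ≤ ρ ^ 2 * cnsq v)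
    (β : Fin n → ZMod p) (S : Finset (Fin n)) (π : Fin n → Bool) (BN : Finset ℕ) (κ τ : ZMod 3) :
    ‖TBVM (modeOf S π) (phase β) (fT BN n κ τ) 0 n 0‖ ≤ ρ ^ ((univ \ S).filter fun i : Fin n => β i ≠ 0).card := by
  have h1 := cnsq_TBVM_le (modeOf S π) (phase β) (fT BN n κ τ) (fT_sq_le BN n κ τ) (siteRhoM S β ρ)
    (cnsq_stepM_modeOf_le hsite S π β) n 0
  rw [prod_siteRhoM_sq, zero_add, TBVM_zero, cnsq_ofReal] at h1
  set s := ((univ \ S).filter fun i : Fin n => β i ≠ 0).card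
  have h2 : cnsq (TBVM (modeOf S π) (phase β) (fT BN n κ τ) 0 n) ≤ (ρ ^ 2) ^ s := by
    refine h1.trans ?_
    have := nsq_fT_last BN n κ τ
    have h0 : 0 ≤ (ρ ^ 2) ^ s := by positivity
    nlinarith
  have h3 : ‖TBVM (modeOf S π) (phase β) (fT BN n κ τ) 0 n 0‖ ^ 2 ≤ (ρ ^ s) ^ 2 := by
    rw [← pow_mul, mul_comm, pow_mul]
    exact (normSq_le_cnsq _ 0).trans h2
  have h4 := abs_le_of_sq_le_sq h3 (by positivity)
  rwa [abs_norm] at h4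

/-- The fibre twisted sum of a constant strategy is small: `≤ 3·ρ^{#(supp β ∖ S)}·2^{n−|S|}`. -/
theorem norm_sum_fibre_sgnU_char_le {ρ : ℝ} (hρ : 0 ≤ ρ)
    (hsite : ∀ a : ZMod p, a ≠ 0 → ∀ v : ZMod 3 → ℂ, cnsq (twAvg (ZMod.stdAddChar a) v) ≤ ρ ^ 2 * cnsq v)
    (c : ℕ) (B : Finset (Fin (n + 1))) (β : Fin n → ZMod p) (S : Finset (Fin n)) (π : Fin n → Bool) :
    ‖∑ u ∈ univ.filter (fun u : Fin n → Bool => ∀ i ∈ S, u i = π i),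
        (sgnU c B u : ℂ) * ∏ i : Fin n, (if u i then phase β i.val else 1)‖ ≤
      3 * ρ ^ ((univ \ S).filter fun i : Fin n => β i ≠ 0).card * (2 : ℝ) ^ (n - S.card) := by
  rw [sum_fibre_sgnU_char]
  set s := ((univ \ S).filter fun i : Fin n => β i ≠ 0).card
  set κ : ZMod 3 := ((c + 2 * n : ℕ) : ZMod 3)
  have hτ : ∀ τ : ZMod 3, ‖(2 : ℂ) ^ (n - S.card) * TBVM (modeOf S π) (phase β) (fT (bellsN B) n κ τ) 0 n 0‖ ≤
      (2 : ℝ) ^ (n - S.card) * ρ ^ s := by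
    intro τ
    rw [norm_mul, norm_pow, Complex.norm_ofNat]
    exact mul_le_mul_of_nonneg_left (norm_TBVM_le hρ hsite β S π _ _ τ) (by positivity)
  have h3 : (∑ τ : ZMod 3, ‖(2 : ℂ) ^ (n - S.card) * TBVM (modeOf S π) (phase β) (fT (bellsN B) n κ τ) 0 n 0‖) =
      ‖(2 : ℂ) ^ (n - S.card) * TBVM (modeOf S π) (phase β) (fT (bellsN B) n κ 0) 0 n 0‖ +
      ‖(2 : ℂ) ^ (n - S.card) * TBVM (modeOf S π) (phase β) (fT (bellsN B) n κ 1) 0 n 0‖ +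
      ‖(2 : ℂ) ^ (n - S.card) * TBVM (modeOf S π) (phase β) (fT (bellsN B) n κ 2) 0 n 0‖ :=
    Fin.sum_univ_three _
  refine (norm_sum_le _ _).trans ?_
  rw [h3]
  have t0 := hτ 0; have t1 := hτ 1; have t2 := hτ 2
  linarith

/-- **Fibre correlation bound from the per-site contraction**: for every oblivious firing set `Y`, charge `c`, phase vector `β`
and pinning `π` on `S`, `|Σ_{u : u|_S = π} [WIN_Y(u)]·e_p(⟨β,u⟩)| ≤ 3·ρ^{#(supp β ∖ S)}·2^{n − |S|}`. -/
theorem corr_win_fibre_le {ρ : ℝ} (hρ : 0 ≤ ρ)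
    (hsite : ∀ a : ZMod p, a ≠ 0 → ∀ v : ZMod 3 → ℂ, cnsq (twAvg (ZMod.stdAddChar a) v) ≤ ρ ^ 2 * cnsq v)
    (c : ℕ) (Y : Finset (Fin (n + 1))) (β : Fin n → ZMod p) (S : Finset (Fin n)) (π : Fin n → Bool) :
    ‖∑ u ∈ univ.filter (fun u : Fin n → Bool => ∀ i ∈ S, u i = π i),
        (if ringWinU c (fun g _ => decide (g ∈ Y)) u = true then (1 : ℂ) else 0) *
        (ZMod.stdAddChar (∑ i : Fin n, if u i then β i else 0) : ℂ)‖ ≤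
      3 * ρ ^ ((univ \ S).filter fun i : Fin n => β i ≠ 0).card * (2 : ℝ) ^ (n - S.card) := by
  set s := ((univ \ S).filter fun i : Fin n => β i ≠ 0).card with hs
  set Fb := univ.filter (fun u : Fin n → Bool => ∀ i ∈ S, u i = π i) with hFb
  have hterm : ∀ u : Fin n → Bool, (if ringWinU c (fun g _ => decide (g ∈ Y)) u = true then (1 : ℂ) else 0) *
      (ZMod.stdAddChar (∑ i : Fin n, if u i then β i else 0) : ℂ) =
      (1 / 2) * ((sgnU c (∅ : Finset (Fin (n + 1))) u : ℂ) * ∏ i : Fin n, (if u i then phase β i.val else 1)) -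
      (1 / 2) * ((sgnU c Y u : ℂ) * ∏ i : Fin n, (if u i then phase β i.val else 1)) := by
    intro u
    rw [win_indicator_eq, char_eq_prod, sgnU_empty]
    push_cast; ring
  simp_rw [hterm]
  rw [Finset.sum_sub_distrib, ← Finset.mul_sum, ← Finset.mul_sum]
  have hA := norm_sum_fibre_sgnU_char_le hρ hsite c (∅ : Finset (Fin (n + 1))) β S π
  have hB := norm_sum_fibre_sgnU_char_le hρ hsite c Y β S π
  calc ‖(1 / 2 : ℂ) * (∑ u ∈ Fb, (sgnU c (∅ : Finset (Fin (n + 1))) u : ℂ) *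
          ∏ i : Fin n, (if u i then phase β i.val else 1)) -
        (1 / 2 : ℂ) * (∑ u ∈ Fb, (sgnU c Y u : ℂ) * ∏ i : Fin n, (if u i then phase β i.val else 1))‖
      ≤ ‖(1 / 2 : ℂ) * (∑ u ∈ Fb, (sgnU c (∅ : Finset (Fin (n + 1))) u : ℂ) *
          ∏ i : Fin n, (if u i then phase β i.val else 1))‖ +
        ‖(1 / 2 : ℂ) * (∑ u ∈ Fb, (sgnU c Y u : ℂ) * ∏ i : Fin n, (if u i then phase β i.val else 1))‖ :=
        norm_sub_le _ _
    _ ≤ 1 / 2 * (3 * ρ ^ s * (2 : ℝ) ^ (n - S.card)) + 1 / 2 * (3 * ρ ^ s * (2 : ℝ) ^ (n - S.card)) := by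
        rw [norm_mul, norm_mul, show ‖(1 / 2 : ℂ)‖ = 1 / 2 from by norm_num]
        gcongr
    _ = 3 * ρ ^ s * (2 : ℝ) ^ (n - S.card) := by ring

end Site

end TwistedTransfer

/-- **`TwistBound p` on a fibre — PROVED for every prime `p ≠ 3`**: with the bits in `S` pinned to `π`,
`‖Σ_{u : u|_S = π} [WIN_Y(u)]·e_p(Σ_{u_i} β_i)‖ ≤ 3√6·cos(π/(3p))^{#(supp β ∖ S)}·2^{n−|S|}`. -/
theorem fibreTwistBound (p : ℕ) [Fact p.Prime] (hp3 : p ≠ 3) :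
    ∀ (n c : ℕ) (S : Finset (Fin n)) (π : Fin n → Bool) (Y : Finset (Fin (n + 1))) (β : Fin n → ZMod p),
      ‖∑ u ∈ (Finset.univ.filter fun u : Fin n → Bool => ∀ i ∈ S, u i = π i),
          (if ringWinU c (fun g _ => decide (g ∈ Y)) u = true then (1 : ℂ) else 0) *
            Complex.exp (2 * Real.pi * Complex.I * (((∑ i, if u i then β i else 0).val : ℝ) : ℂ) / (p : ℂ))‖
        ≤ 3 * Real.sqrt 6 * Real.cos (Real.pi / (3 * p)) ^ ((Finset.univ \ S).filter fun i => β i ≠ 0).card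
            * (2 : ℝ) ^ (n - S.card) := by
  intro n c S π Y β
  have hp2 : 2 ≤ p := (Fact.out : p.Prime).two_le
  have hcop : p.Coprime 3 := (Nat.coprime_primes (Fact.out : p.Prime) Nat.prime_three).2 hp3
  have hcos : 0 ≤ Real.cos (Real.pi / (3 * p)) := by
    apply Real.cos_nonneg_of_neg_pi_div_two_le_of_le
    · have : 0 ≤ Real.pi / (3 * p) := by positivity
      linarith [Real.pi_pos]
    · rw [div_le_div_iff₀ (by positivity) (by norm_num)]
      have : (2 : ℝ) ≤ p := by exact_mod_cast hp2
      nlinarith [Real.pi_pos]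
  -- the per-site contraction (as in `twistBound`)
  have hsite : ∀ a : ZMod p, a ≠ 0 → ∀ v : ZMod 3 → ℂ,
      TwistedTransfer.cnsq (TwistedTransfer.twAvg (ZMod.stdAddChar a) v) ≤
        Real.cos (Real.pi / (3 * p)) ^ 2 * TwistedTransfer.cnsq v := by
    intro a ha v
    have h := Literature.Computability.MetaComplexity.TwoModuli.sum_norm_sq_twistStep_three_le hcop ha 1 2
      (X := Unit) (fun sx => v sx.1)
    rw [Fintype.sum_prod_type, Fintype.sum_prod_type] at h
    simp only [Finset.sum_const, Finset.card_univ, Fintype.card_unit, one_smul] at h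
    have hl : (∑ s : ZMod 3, ‖v (s + 1) + ZMod.stdAddChar a * v (s + 2)‖ ^ 2) =
        4 * TwistedTransfer.cnsq (TwistedTransfer.twAvg (ZMod.stdAddChar a) v) := by
      rw [show (∑ s : ZMod 3, ‖v (s + 1) + ZMod.stdAddChar a * v (s + 2)‖ ^ 2) =
        ‖v (0 + 1) + ZMod.stdAddChar a * v (0 + 2)‖ ^ 2 + ‖v (1 + 1) + ZMod.stdAddChar a * v (1 + 2)‖ ^ 2 +
        ‖v (2 + 1) + ZMod.stdAddChar a * v (2 + 2)‖ ^ 2 from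
        Fin.sum_univ_three (fun s : ZMod 3 => ‖v (s + 1) + ZMod.stdAddChar a * v (s + 2)‖ ^ 2)]
      unfold TwistedTransfer.cnsq TwistedTransfer.twAvg
      simp only [norm_div, Complex.norm_ofNat, div_pow]
      ring
    have hr : (∑ s : ZMod 3, ‖v s‖ ^ 2) = TwistedTransfer.cnsq v := Fin.sum_univ_three (fun s : ZMod 3 => ‖v s‖ ^ 2)
    rw [hl, hr] at h
    nlinarith [TwistedTransfer.cnsq_nonneg v, sq_nonneg (Real.cos (Real.pi / (3 * p)))]
  have hchar : ∀ u : Fin n → Bool,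
      Complex.exp (2 * Real.pi * Complex.I * (((∑ i, if u i then β i else 0).val : ℝ) : ℂ) / (p : ℂ)) =
        (ZMod.stdAddChar (∑ i : Fin n, if u i then β i else 0) : ℂ) := by
    intro u
    rw [show (ZMod.stdAddChar (∑ i : Fin n, if u i then β i else 0) : ℂ) =
      (ZMod.toCircle (∑ i : Fin n, if u i then β i else 0) : ℂ) from rfl, ZMod.toCircle_apply]
    push_cast; ring_nf
  simp_rw [hchar]
  refine (TwistedTransfer.corr_win_fibre_le hcos hsite c Y β S π).trans ?_
  have h6 : (1 : ℝ) ≤ Real.sqrt 6 := by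
    rw [show (1 : ℝ) = Real.sqrt 1 from Real.sqrt_one.symm]
    exact Real.sqrt_le_sqrt (by norm_num)
  have hpow : 0 ≤ Real.cos (Real.pi / (3 * p)) ^ ((Finset.univ \ S).filter fun i => β i ≠ 0).card
      * (2 : ℝ) ^ (n - S.card) := by positivity
  nlinarith

end Summit.QuantumAdvantage.AdviceFreeQNC0

namespace Summit.QuantumAdvantage.QuantumAdvantage.Theorems

open Finset

set_option linter.dupNamespace false in
/-- **`FibreTwistBoundFive`** (item stmt-QuantumAdvantage-24323, route OddPrimeWalk; the route file's signature verbatim):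
`TwistBound 5` on a fibre `{u : u|_S = π}`, exponent `#(supp β ∖ S)`, mass `2^{n − |S|}`. -/
theorem oddPrimeWalk_fibreTwistBoundFive :
    ∀ (n c : ℕ) (S : Finset (Fin n)) (π : Fin n → Bool) (Y : Finset (Fin (n + 1))) (β : Fin n → ZMod 5), ‖∑ u ∈ (Finset.univ.filter fun u : Fin n → Bool => ∀ i ∈ S, u i = π i), (if Summit.QuantumAdvantage.AdviceFreeQNC0.ringWinU c (fun g _ => decide (g ∈ Y)) u = true then (1 : ℂ) else 0) * Complex.exp (2 * Real.pi * Complex.I * (((∑ i, if u i then β i else 0).val : ℝ) : ℂ) / (5 : ℂ))‖ ≤ 3 * Real.sqrt 6 * Real.cos (Real.pi / 15) ^ ((Finset.univ \ S).filter fun i => β i ≠ 0).card * (2 : ℝ) ^ (n - S.card) := by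
  haveI : Fact (Nat.Prime 5) := ⟨by norm_num⟩
  intro n c S π Y β
  have h := Summit.QuantumAdvantage.AdviceFreeQNC0.fibreTwistBound 5 (by norm_num) n c S π Y β
  rw [show (3 : ℝ) * (5 : ℕ) = 15 from by norm_num] at h
  exact_mod_cast h

end Summit.QuantumAdvantage.QuantumAdvantage.Theorems

end
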